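import Summits.AtomisticToContinuum.BoseEinsteinCondensation.Theorems.BECInsertionCorrectorCorrectorClosureResponseDictionaryCalculus
import Summits.AtomisticToContinuum.BoseEinsteinCondensation.Theorems.BECInsertionCorrectorCorrectorClosureResponseDictionaryMollifier
import HarnessLib

/-!
# Response dictionary, part C: the discriminant trick and the passage to the limit

Support file for the registered stub `stub_responseDictionary` of line `healing-scale-kac-insertion`
(crux `BECInsertionCorrector.CorrectorClosure`, item stmt-AtomisticToContinuum-12058). From the
variational response inequality in real form ("`(E₀ - C t²)∫f² ≤ ∫|∇f|² + ∫f²V + t∫f²g` for every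
symmetric periodic `C¹` `f` of positive mass") and an approximating sequence `F_n → Θ₀` (uniformly,
with kinetic integrals `≤ E₀ - ∫Θ₀²V`), the second-order expansion along `(1 + sβ)F_n` gives a
nonnegative quadratic `a_n + 2s b_n + s² c_n` on `|s| ≤ s₀` with `a_n → 0` and `c_n` bounded, whence
`b_n → 0` (weak Euler–Lagrange in the limit) and `c_n(β) = b_n(β²) + ∫F_n²|∇β|² → ∫Θ₀²|∇β|²`
(ground-state representation in the limit); the response inequality then passes to the limit:
`-C t²(1 + 2s∫Θ₀²β + s²∫Θ₀²β²) ≤ s²∫Θ₀²|∇β|² + t(∫Θ₀²g + 2s∫Θ₀²βg + s²∫Θ₀²β²g)`.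
Supports (does not close) stmt-AtomisticToContinuum-12058, route `BECInsertionCorrector`.
-/

noncomputable section

open MeasureTheory Filter
open scoped ENNReal NNReal BigOperators Topology

namespace Summit.AtomisticToContinuum.BoseEinsteinCondensation.Theorems.CorrectorClosure.HealingScaleKacInsertion.ResponseDictionary

open Literature.MathematicalPhysics.QuantumManyBody.BoseGas

variable {N : ℕ}

/-! ### Two lemmas on real sequences -/

/-- **The discriminant trick, sequence form.** If the quadratics `a_n + 2s b_n + s² c_n` are
eventually nonnegative on `|s| ≤ s₀`, `c_n ≤ C` and `a_n → 0`, then `b_n → 0`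
(`|b_n| ≤ a_n/(2σ) + σC/2` for every `0 < σ ≤ s₀`). [folklore] -/
theorem tendsto_zero_of_quadratic_nonneg {a b c : ℕ → ℝ} {s₀ Cb : ℝ} (hs₀ : 0 < s₀)
    (hq : ∀ᶠ n in atTop, ∀ s : ℝ, |s| ≤ s₀ → 0 ≤ a n + 2 * s * b n + s ^ 2 * c n)
    (hc : ∀ n, c n ≤ Cb) (ha : Tendsto a atTop (𝓝 0)) : Tendsto b atTop (𝓝 0) := by
  rw [Metric.tendsto_nhds] at ha ⊢
  intro ε hε
  have hmax : 0 ≤ max Cb 0 := le_max_right _ _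
  set C' : ℝ := max Cb 0 + 1 with hC'
  have hC'0 : 0 < C' := by rw [hC']; linarith
  set σ : ℝ := min s₀ (ε / C') with hσ
  have hσ0 : 0 < σ := lt_min hs₀ (div_pos hε hC'0)
  have hσs : σ ≤ s₀ := min_le_left _ _
  have hσC : σ * max Cb 0 < ε := by
    have h1 : σ ≤ ε / C' := min_le_right _ _
    have h2 : ε / C' * max Cb 0 < ε := by
      rw [div_mul_eq_mul_div, div_lt_iff₀ hC'0, hC']; nlinarith
    exact (mul_le_mul_of_nonneg_right h1 hmax).trans_lt h2
  filter_upwards [hq, ha (ε * σ) (mul_pos hε hσ0)] with n hn han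
  rw [Real.dist_eq, sub_zero] at han ⊢
  have hp := hn σ (by rw [abs_of_pos hσ0]; exact hσs)
  have hm := hn (-σ) (by rw [abs_neg, abs_of_pos hσ0]; exact hσs)
  have hcn : σ ^ 2 * c n ≤ σ ^ 2 * max Cb 0 :=
    mul_le_mul_of_nonneg_left ((hc n).trans (le_max_left _ _)) (sq_nonneg _)
  have key : σ * (σ * max Cb 0) < σ * ε := mul_lt_mul_of_pos_left hσC hσ0
  have ha' := abs_lt.1 han
  have h2 : 2 * σ * b n < 2 * σ * ε := by nlinarith
  have h1 : 2 * σ * -ε < 2 * σ * b n := by nlinarith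
  have h2σ : 0 < 2 * σ := by positivity
  exact abs_lt.2 ⟨lt_of_mul_lt_mul_left h1 h2σ.le, lt_of_mul_lt_mul_left h2 h2σ.le⟩

/-- **Passing to the limit in the expanded response inequality** (all coefficients converge).
[folklore] -/
theorem limit_response_ineq {W Wb Wb2 a b c G Gb Gb2 : ℕ → ℝ}
    {B₁ B₂ D G₀ G₁ G₂ CK s t : ℝ}
    (hW : Tendsto W atTop (𝓝 1)) (hWb : Tendsto Wb atTop (𝓝 B₁)) (hWb2 : Tendsto Wb2 atTop (𝓝 B₂))
    (ha : Tendsto a atTop (𝓝 0)) (hb : Tendsto b atTop (𝓝 0)) (hc : Tendsto c atTop (𝓝 D))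
    (hG : Tendsto G atTop (𝓝 G₀)) (hGb : Tendsto Gb atTop (𝓝 G₁)) (hGb2 : Tendsto Gb2 atTop (𝓝 G₂))
    (hineq : ∀ᶠ n in atTop,
      -(CK * t ^ 2) * (W n + 2 * s * Wb n + s ^ 2 * Wb2 n) ≤
        a n + 2 * s * b n + s ^ 2 * c n + t * (G n + 2 * s * Gb n + s ^ 2 * Gb2 n)) :
    -(CK * t ^ 2) * (1 + 2 * s * B₁ + s ^ 2 * B₂) ≤
      s ^ 2 * D + t * (G₀ + 2 * s * G₁ + s ^ 2 * G₂) := by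
  have h1 : Tendsto (fun n => -(CK * t ^ 2) * (W n + 2 * s * Wb n + s ^ 2 * Wb2 n)) atTop
      (𝓝 (-(CK * t ^ 2) * (1 + 2 * s * B₁ + s ^ 2 * B₂))) :=
    ((hW.add (hWb.const_mul _)).add (hWb2.const_mul _)).const_mul _
  have h2 : Tendsto (fun n => a n + 2 * s * b n + s ^ 2 * c n +
      t * (G n + 2 * s * Gb n + s ^ 2 * Gb2 n)) atTop
      (𝓝 (0 + 2 * s * 0 + s ^ 2 * D + t * (G₀ + 2 * s * G₁ + s ^ 2 * G₂))) :=
    ((ha.add (hb.const_mul _)).add (hc.const_mul _)).add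
      (((hG.add (hGb.const_mul _)).add (hGb2.const_mul _)).const_mul _)
  have := le_of_tendsto_of_tendsto h1 h2 hineq
  simpa only [mul_zero, zero_add] using this

/-! ### The expanded response inequality along `(1 + sβ)F` -/

/-- **Expanded response inequality.** If the variational response inequality
`(E₀ - C t²)∫f² ≤ ∫|∇f|² + ∫f²V + t∫f²g` holds for every symmetric periodic `C¹` `f` of positive
mass on the cell, then for symmetric periodic `C¹` `F` (mass `> 1/2`), `β` (`|β| ≤ B`) and
`|s| ≤ 1/(2B+2)` it holds for `f = (1 + sβ)F`, with every term expanded to second order in `s`.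
[folklore] -/
theorem expanded_response {L : ℝ} {Vr g : Config N → ℝ} {E₀ CK : ℝ}
    (hVR : ∀ f : Config N → ℝ, ContDiff ℝ 1 f →
      (∀ (X : Config N) (i : Fin N) (k : Fin 3),
        f (X + Pi.single i (EuclideanSpace.single k L)) = f X) →
      (∀ (σ : Equiv.Perm (Fin N)) (X : Config N), f (X ∘ σ) = f X) →
      0 < ∫ X in cellN N L, f X ^ 2 → ∀ t : ℝ,
      (E₀ - CK * t ^ 2) * ∫ X in cellN N L, f X ^ 2 ≤
        (∫ X in cellN N L, gradDot f f X) + (∫ X in cellN N L, f X ^ 2 * Vr X) +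
          t * ∫ X in cellN N L, f X ^ 2 * g X)
    (hVr : Measurable Vr) {CV : ℝ} (hCV : ∀ X, |Vr X| ≤ CV)
    (hg : Measurable g) {Bg : ℝ} (hBg : ∀ X, |g X| ≤ Bg)
    {F : Config N → ℝ} (hF : ContDiff ℝ 1 F)
    (hFper : ∀ (X : Config N) (i : Fin N) (k : Fin 3),
      F (X + Pi.single i (EuclideanSpace.single k L)) = F X)
    (hFsymm : ∀ (σ : Equiv.Perm (Fin N)) (X : Config N), F (X ∘ σ) = F X)
    {M : ℝ} (hFM : ∀ X, |F X| ≤ M) (hmass : 1 / 2 < ∫ X in cellN N L, F X ^ 2)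
    {β : Config N → ℝ} (hβ : ContDiff ℝ 1 β)
    (hβper : ∀ (X : Config N) (i : Fin N) (k : Fin 3),
      β (X + Pi.single i (EuclideanSpace.single k L)) = β X)
    (hβsymm : ∀ (σ : Equiv.Perm (Fin N)) (X : Config N), β (X ∘ σ) = β X)
    {Bβ : ℝ} (hBβ : ∀ X, |β X| ≤ Bβ) {s : ℝ} (hs : |s| ≤ 1 / (2 * Bβ + 2)) (t : ℝ) :
    -(CK * t ^ 2) * ((∫ X in cellN N L, F X ^ 2) + 2 * s * (∫ X in cellN N L, F X ^ 2 * β X) +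
        s ^ 2 * ∫ X in cellN N L, F X ^ 2 * β X ^ 2) ≤
      ((∫ X in cellN N L, gradDot F F X) + (∫ X in cellN N L, F X ^ 2 * Vr X) -
          E₀ * ∫ X in cellN N L, F X ^ 2) +
        2 * s * ((∫ X in cellN N L, (β X * gradDot F F X + F X * gradDot β F X)) +
          (∫ X in cellN N L, F X ^ 2 * (β X * Vr X)) - E₀ * ∫ X in cellN N L, F X ^ 2 * β X) +
        s ^ 2 * ((∫ X in cellN N L, (β X ^ 2 * gradDot F F X + 2 * (β X * F X * gradDot β F X) +
            F X ^ 2 * gradDot β β X)) +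
          (∫ X in cellN N L, F X ^ 2 * (β X ^ 2 * Vr X)) -
            E₀ * ∫ X in cellN N L, F X ^ 2 * β X ^ 2) +
        t * ((∫ X in cellN N L, F X ^ 2 * g X) + 2 * s * (∫ X in cellN N L, F X ^ 2 * (β X * g X)) +
          s ^ 2 * ∫ X in cellN N L, F X ^ 2 * (β X ^ 2 * g X)) := by
  have hFc := hF.continuous
  have hβc := hβ.continuous
  have hfC : ContDiff ℝ 1 fun Y => (1 + s * β Y) * F Y :=
    (contDiff_const.add (contDiff_const.mul hβ)).mul hF
  have hfper : ∀ (X : Config N) (i : Fin N) (k : Fin 3),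
      (fun Y => (1 + s * β Y) * F Y) (X + Pi.single i (EuclideanSpace.single k L)) =
        (fun Y => (1 + s * β Y) * F Y) X := by
    intro X i k; simp only [hβper, hFper]
  have hfsymm : ∀ (σ : Equiv.Perm (Fin N)) (X : Config N),
      (fun Y => (1 + s * β Y) * F Y) (X ∘ σ) = (fun Y => (1 + s * β Y) * F Y) X := by
    intro σ X; simp only [hβsymm, hFsymm]
  -- the mass of `f` is at least a quarter of the mass of `F`
  have hBβ0 : 0 ≤ Bβ := (abs_nonneg _).trans (hBβ 0)
  have hsβ : ∀ X, |s * β X| ≤ 1 / 2 := by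
    intro X
    rw [abs_mul]
    calc |s| * |β X| ≤ 1 / (2 * Bβ + 2) * Bβ := mul_le_mul hs (hBβ X) (abs_nonneg _) (by positivity)
      _ ≤ 1 / 2 := by
          rw [div_mul_eq_mul_div, one_mul, div_le_iff₀ (by positivity)]; linarith
  have hquarter : ∀ X, 1 / 4 * F X ^ 2 ≤ ((1 + s * β X) * F X) ^ 2 := by
    intro X
    have h := abs_le.1 (hsβ X)
    have h14 : (1 / 4 : ℝ) ≤ (1 + s * β X) ^ 2 := by nlinarith
    rw [mul_pow]
    exact mul_le_mul_of_nonneg_right h14 (sq_nonneg _)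
  have hmass_f : 0 < ∫ X in cellN N L, ((1 + s * β X) * F X) ^ 2 := by
    have hint1 : IntegrableOn (fun X => 1 / 4 * F X ^ 2) (cellN N L) :=
      integrableOn_cellN (continuous_const.mul (hFc.pow 2)) L
    have hint2 : IntegrableOn (fun X => ((1 + s * β X) * F X) ^ 2) (cellN N L) :=
      integrableOn_cellN (hfC.continuous.pow 2) L
    have hle := setIntegral_mono_on hint1 hint2 (measurableSet_cellN N L) fun X _ => hquarter X
    rw [integral_const_mul] at hle
    linarith
  have key := hVR (fun Y => (1 + s * β Y) * F Y) hfC hfper hfsymm hmass_f t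
  beta_reduce at key
  -- integrability of the weighted masses
  have hFm : Measurable F := hFc.measurable
  have hβm : Measurable β := hβc.measurable
  have iw : ∀ (w : Config N → ℝ) (B : ℝ), Measurable w → (∀ X, |w X| ≤ B) →
      IntegrableOn (fun X => F X ^ 2 * w X) (cellN N L) := fun w B hw hB =>
    integrableOn_cellN_of_abs_le ((hFm.pow_const 2).mul hw)
      (abs_mul_le_forall (abs_sq_le_forall hFM) hB)
  have hβ2 : ∀ X, |β X ^ 2| ≤ Bβ ^ 2 := abs_sq_le_forall hBβ
  have e1 := integral_sq_perturb (L := L) hβc hFc s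
  have e2 := integral_gradDot_perturb (L := L) hβ hF s
  have e3 := integral_sq_perturb_mul (L := L) (β := β) (F := F) (w := Vr) s (iw Vr CV hVr hCV)
    (iw _ _ (hβm.mul hVr) (abs_mul_le_forall hBβ hCV))
    (iw _ _ ((hβm.pow_const 2).mul hVr) (abs_mul_le_forall hβ2 hCV))
  have e4 := integral_sq_perturb_mul (L := L) (β := β) (F := F) (w := g) s (iw g Bg hg hBg)
    (iw _ _ (hβm.mul hg) (abs_mul_le_forall hBβ hBg))
    (iw _ _ ((hβm.pow_const 2).mul hg) (abs_mul_le_forall hβ2 hBg))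
  rw [e1, e2, e3, e4] at key
  linarith

/-! ### The limit inequality for an approximating sequence -/

/-- **The response inequality in the limit `F_n → Θ₀`.** Let the variational response inequality
hold (as in `expanded_response`), let `F_n` be symmetric periodic `C¹` functions with
`|F_n|, |Θ₀| ≤ M`, `F_n → Θ₀` uniformly, `∫Θ₀² = 1` and kinetic integrals `≤ E₀ - ∫Θ₀²V`
(`E₀ ≥ 0`, `V`, `g` bounded measurable). Then for every symmetric periodic `C¹` `β` there is
`s₀ > 0` with, for all `|s| ≤ s₀` and all real `t`,
`-C t²(1 + 2s∫Θ₀²β + s²∫Θ₀²β²) ≤ s²∫Θ₀²|∇β|² + t(∫Θ₀²g + 2s∫Θ₀²βg + s²∫Θ₀²β²g)`: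
the discriminant trick kills the first-order kinetic coefficient and turns the second-order one
into the Dirichlet form `∫Θ₀²|∇β|²` (no form domain, no integration by parts). [folklore] -/
theorem limit_response_of_approx {L : ℝ} (hL : 0 < L) {Vr g Θ₀ : Config N → ℝ} {E₀ CK : ℝ}
    (hE₀ : 0 ≤ E₀)
    (hVR : ∀ f : Config N → ℝ, ContDiff ℝ 1 f →
      (∀ (X : Config N) (i : Fin N) (k : Fin 3),
        f (X + Pi.single i (EuclideanSpace.single k L)) = f X) →
      (∀ (σ : Equiv.Perm (Fin N)) (X : Config N), f (X ∘ σ) = f X) →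
      0 < ∫ X in cellN N L, f X ^ 2 → ∀ t : ℝ,
      (E₀ - CK * t ^ 2) * ∫ X in cellN N L, f X ^ 2 ≤
        (∫ X in cellN N L, gradDot f f X) + (∫ X in cellN N L, f X ^ 2 * Vr X) +
          t * ∫ X in cellN N L, f X ^ 2 * g X)
    (hVr : Measurable Vr) {CV : ℝ} (hCV : ∀ X, |Vr X| ≤ CV)
    (hg : Measurable g) {Bg : ℝ} (hBg : ∀ X, |g X| ≤ Bg)
    (hΘc : Continuous Θ₀) {M : ℝ} (hΘM : ∀ X, |Θ₀ X| ≤ M)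
    (hnorm : ∫ X in cellN N L, Θ₀ X ^ 2 = 1)
    {F : ℕ → Config N → ℝ} (hFC : ∀ n, ContDiff ℝ 1 (F n))
    (hFper : ∀ (n : ℕ) (X : Config N) (i : Fin N) (k : Fin 3),
      F n (X + Pi.single i (EuclideanSpace.single k L)) = F n X)
    (hFsymm : ∀ (n : ℕ) (σ : Equiv.Perm (Fin N)) (X : Config N), F n (X ∘ σ) = F n X)
    (hFM : ∀ n X, |F n X| ≤ M)
    (hunif : ∀ s : ℝ, 0 < s → ∀ᶠ n : ℕ in atTop, ∀ X, |F n X - Θ₀ X| ≤ s)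
    (hkin : ∀ n, ∫ X in cellN N L, gradDot (F n) (F n) X ≤
      E₀ - ∫ X in cellN N L, Θ₀ X ^ 2 * Vr X)
    {β : Config N → ℝ} (hβ : ContDiff ℝ 1 β)
    (hβper : ∀ (X : Config N) (i : Fin N) (k : Fin 3),
      β (X + Pi.single i (EuclideanSpace.single k L)) = β X)
    (hβsymm : ∀ (σ : Equiv.Perm (Fin N)) (X : Config N), β (X ∘ σ) = β X) :
    ∃ s₀ : ℝ, 0 < s₀ ∧ ∀ s : ℝ, |s| ≤ s₀ → ∀ t : ℝ,
      -(CK * t ^ 2) * (1 + 2 * s * (∫ X in cellN N L, Θ₀ X ^ 2 * β X) +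
          s ^ 2 * ∫ X in cellN N L, Θ₀ X ^ 2 * β X ^ 2) ≤
        s ^ 2 * (∫ X in cellN N L, Θ₀ X ^ 2 * gradDot β β X) +
          t * ((∫ X in cellN N L, Θ₀ X ^ 2 * g X) +
            2 * s * (∫ X in cellN N L, Θ₀ X ^ 2 * (β X * g X)) +
            s ^ 2 * ∫ X in cellN N L, Θ₀ X ^ 2 * (β X ^ 2 * g X)) := by
  have hΘm : Measurable Θ₀ := hΘc.measurable
  have hFm : ∀ n, Measurable (F n) := fun n => (hFC n).continuous.measurable
  set vol : ℝ := (volume (cellN N L)).toReal with hvol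
  have hvol0 : 0 ≤ vol := ENNReal.toReal_nonneg
  set P₀ : ℝ := ∫ X in cellN N L, Θ₀ X ^ 2 * Vr X with hP₀
  -- convergence of weighted masses with bounded measurable weights
  have conv : ∀ (w : Config N → ℝ) (B : ℝ), Measurable w → (∀ X, |w X| ≤ B) →
      Tendsto (fun n => ∫ X in cellN N L, F n X ^ 2 * w X) atTop
        (𝓝 (∫ X in cellN N L, Θ₀ X ^ 2 * w X)) := by
    intro w B hw hB
    refine tendsto_integral_sq_mul hΘM hFM hunif hB ?_ ?_
    · exact integrableOn_cellN_of_abs_le ((hΘm.pow_const 2).mul hw)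
        (abs_mul_le_forall (abs_sq_le_forall hΘM) hB)
    · intro n
      exact integrableOn_cellN_of_abs_le (((hFm n).pow_const 2).mul hw)
        (abs_mul_le_forall (abs_sq_le_forall (hFM n)) hB)
  -- the mass tends to one; eventually it exceeds `1/2`
  have hW : Tendsto (fun n => ∫ X in cellN N L, F n X ^ 2) atTop (𝓝 1) := by
    have h := conv (fun _ => (1 : ℝ)) 1 measurable_const fun _ => by simp
    simp only [mul_one, hnorm] at h
    exact h
  have hmass : ∀ᶠ n : ℕ in atTop, 1 / 2 < ∫ X in cellN N L, F n X ^ 2 :=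
    hW.eventually_const_lt (by norm_num)
  -- the expanded response inequality, eventually, for every admissible `γ`
  have hERI : ∀ (γ : Config N → ℝ), ContDiff ℝ 1 γ →
      (∀ (X : Config N) (i : Fin N) (k : Fin 3),
        γ (X + Pi.single i (EuclideanSpace.single k L)) = γ X) →
      (∀ (σ : Equiv.Perm (Fin N)) (X : Config N), γ (X ∘ σ) = γ X) →
      ∀ (Bγ : ℝ), (∀ X, |γ X| ≤ Bγ) →
      ∀ᶠ n : ℕ in atTop, ∀ s : ℝ, |s| ≤ 1 / (2 * Bγ + 2) → ∀ t : ℝ,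
        -(CK * t ^ 2) * ((∫ X in cellN N L, F n X ^ 2) +
            2 * s * (∫ X in cellN N L, F n X ^ 2 * γ X) +
            s ^ 2 * ∫ X in cellN N L, F n X ^ 2 * γ X ^ 2) ≤
          ((∫ X in cellN N L, gradDot (F n) (F n) X) + (∫ X in cellN N L, F n X ^ 2 * Vr X) -
              E₀ * ∫ X in cellN N L, F n X ^ 2) +
            2 * s * ((∫ X in cellN N L, (γ X * gradDot (F n) (F n) X + F n X * gradDot γ (F n) X)) +
              (∫ X in cellN N L, F n X ^ 2 * (γ X * Vr X)) -
                E₀ * ∫ X in cellN N L, F n X ^ 2 * γ X) +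
            s ^ 2 * ((∫ X in cellN N L, (γ X ^ 2 * gradDot (F n) (F n) X +
                2 * (γ X * F n X * gradDot γ (F n) X) + F n X ^ 2 * gradDot γ γ X)) +
              (∫ X in cellN N L, F n X ^ 2 * (γ X ^ 2 * Vr X)) -
                E₀ * ∫ X in cellN N L, F n X ^ 2 * γ X ^ 2) +
            t * ((∫ X in cellN N L, F n X ^ 2 * g X) +
              2 * s * (∫ X in cellN N L, F n X ^ 2 * (γ X * g X)) +
              s ^ 2 * ∫ X in cellN N L, F n X ^ 2 * (γ X ^ 2 * g X)) := by
    intro γ hγ hγper hγsymm Bγ hBγ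
    filter_upwards [hmass] with n hn s hs t
    exact expanded_response hVR hVr hCV hg hBg (hFC n) (hFper n) (hFsymm n) (hFM n) hn hγ hγper
      hγsymm hBγ hs t
  -- `a_n → 0`
  obtain ⟨Bβ, hBβ0, hBβ⟩ := exists_bound_of_continuous_periodic hL hβ.continuous hβper
  have hs₀ : 0 < 1 / (2 * Bβ + 2) := by positivity
  have ha : Tendsto (fun n => (∫ X in cellN N L, gradDot (F n) (F n) X) +
      (∫ X in cellN N L, F n X ^ 2 * Vr X) - E₀ * ∫ X in cellN N L, F n X ^ 2) atTop (𝓝 0) := by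
    have hlow : ∀ᶠ n : ℕ in atTop, 0 ≤ (∫ X in cellN N L, gradDot (F n) (F n) X) +
        (∫ X in cellN N L, F n X ^ 2 * Vr X) - E₀ * ∫ X in cellN N L, F n X ^ 2 := by
      filter_upwards [hERI β hβ hβper hβsymm Bβ hBβ] with n hn
      have h := hn 0 (by rw [abs_zero]; exact hs₀.le) 0
      have h00 : (0 : ℝ) ^ 2 = 0 := by norm_num
      simp only [h00, mul_zero, zero_mul, neg_zero, add_zero] at h
      exact h
    have hup : ∀ n, (∫ X in cellN N L, gradDot (F n) (F n) X) +
        (∫ X in cellN N L, F n X ^ 2 * Vr X) - E₀ * ∫ X in cellN N L, F n X ^ 2 ≤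
        (E₀ - P₀) + (∫ X in cellN N L, F n X ^ 2 * Vr X) - E₀ * ∫ X in cellN N L, F n X ^ 2 :=
      fun n => by linarith [hkin n]
    have hlim : Tendsto (fun n => (E₀ - P₀) + (∫ X in cellN N L, F n X ^ 2 * Vr X) -
        E₀ * ∫ X in cellN N L, F n X ^ 2) atTop (𝓝 ((E₀ - P₀) + P₀ - E₀ * 1)) :=
      (tendsto_const_nhds.add (conv Vr CV hVr hCV)).sub (hW.const_mul _)
    rw [show (E₀ - P₀) + P₀ - E₀ * 1 = 0 by ring] at hlim
    exact tendsto_of_tendsto_of_tendsto_of_le_of_le' tendsto_const_nhds hlim hlow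
      (Eventually.of_forall hup)
  -- `b_n(γ) → 0` for every admissible `γ` (the discriminant trick)
  have hb : ∀ (γ : Config N → ℝ), ContDiff ℝ 1 γ →
      (∀ (X : Config N) (i : Fin N) (k : Fin 3),
        γ (X + Pi.single i (EuclideanSpace.single k L)) = γ X) →
      (∀ (σ : Equiv.Perm (Fin N)) (X : Config N), γ (X ∘ σ) = γ X) →
      Tendsto (fun n => (∫ X in cellN N L, (γ X * gradDot (F n) (F n) X + F n X * gradDot γ (F n) X)) +
        (∫ X in cellN N L, F n X ^ 2 * (γ X * Vr X)) - E₀ * ∫ X in cellN N L, F n X ^ 2 * γ X)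
        atTop (𝓝 0) := by
    intro γ hγ hγper hγsymm
    obtain ⟨Bγ, hBγ0, hBγ⟩ := exists_bound_of_continuous_periodic hL hγ.continuous hγper
    obtain ⟨BΓ, hBΓ0, hBΓ⟩ := exists_gradDot_le_of_periodic hL hγ hγper
    have hsγ : 0 < 1 / (2 * Bγ + 2) := by positivity
    have hγ2 : ∀ X, |γ X ^ 2| ≤ Bγ ^ 2 := abs_sq_le_forall hBγ
    -- uniform bound on the second-order coefficient
    have hc : ∀ n, (∫ X in cellN N L, (γ X ^ 2 * gradDot (F n) (F n) X +
        2 * (γ X * F n X * gradDot γ (F n) X) + F n X ^ 2 * gradDot γ γ X)) +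
        (∫ X in cellN N L, F n X ^ 2 * (γ X ^ 2 * Vr X)) - E₀ * ∫ X in cellN N L, F n X ^ 2 * γ X ^ 2 ≤
        (Bγ ^ 2 + 1) * ((E₀ - P₀) + M ^ 2 * BΓ * vol) + M ^ 2 * (Bγ ^ 2 * CV) * vol := by
      intro n
      have h1 := integral_cKin_le (L := L) hγ (hFC n) hBγ
      have h2 : ∫ X in cellN N L, F n X ^ 2 * gradDot γ γ X ≤ M ^ 2 * BΓ * vol :=
        (le_abs_self _).trans (abs_integral_sq_mul_le (hFM n) hBΓ)
      have h3 : ∫ X in cellN N L, F n X ^ 2 * (γ X ^ 2 * Vr X) ≤ M ^ 2 * (Bγ ^ 2 * CV) * vol :=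
        (le_abs_self _).trans (abs_integral_sq_mul_le (hFM n) (abs_mul_le_forall hγ2 hCV))
      have h4 : 0 ≤ ∫ X in cellN N L, F n X ^ 2 * γ X ^ 2 :=
        integral_nonneg fun X => mul_nonneg (sq_nonneg _) (sq_nonneg _)
      have h5 : (Bγ ^ 2 + 1) * ((∫ X in cellN N L, gradDot (F n) (F n) X) +
          ∫ X in cellN N L, F n X ^ 2 * gradDot γ γ X) ≤
          (Bγ ^ 2 + 1) * ((E₀ - P₀) + M ^ 2 * BΓ * vol) :=
        mul_le_mul_of_nonneg_left (by linarith [hkin n]) (by positivity)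
      nlinarith [mul_nonneg hE₀ h4]
    have hq : ∀ᶠ n : ℕ in atTop, ∀ s : ℝ, |s| ≤ 1 / (2 * Bγ + 2) →
        0 ≤ ((∫ X in cellN N L, gradDot (F n) (F n) X) + (∫ X in cellN N L, F n X ^ 2 * Vr X) -
            E₀ * ∫ X in cellN N L, F n X ^ 2) +
          2 * s * ((∫ X in cellN N L, (γ X * gradDot (F n) (F n) X + F n X * gradDot γ (F n) X)) +
            (∫ X in cellN N L, F n X ^ 2 * (γ X * Vr X)) - E₀ * ∫ X in cellN N L, F n X ^ 2 * γ X) +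
          s ^ 2 * ((∫ X in cellN N L, (γ X ^ 2 * gradDot (F n) (F n) X +
              2 * (γ X * F n X * gradDot γ (F n) X) + F n X ^ 2 * gradDot γ γ X)) +
            (∫ X in cellN N L, F n X ^ 2 * (γ X ^ 2 * Vr X)) -
              E₀ * ∫ X in cellN N L, F n X ^ 2 * γ X ^ 2) := by
      filter_upwards [hERI γ hγ hγper hγsymm Bγ hBγ] with n hn s hs
      have h := hn s hs 0
      have h00 : (0 : ℝ) ^ 2 = 0 := by norm_num
      simp only [h00, mul_zero, zero_mul, neg_zero, add_zero] at h
      exact h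
    exact tendsto_zero_of_quadratic_nonneg hsγ hq hc ha
  -- `c_n(β) → ∫Θ₀²|∇β|²` : `c_n(β) = b_n(β²) + ∫F_n²|∇β|²`
  obtain ⟨BΓ, hBΓ0, hBΓ⟩ := exists_gradDot_le_of_periodic hL hβ hβper
  have hβ2C : ContDiff ℝ 1 fun Y => β Y ^ 2 := hβ.pow 2
  have hβ2per : ∀ (X : Config N) (i : Fin N) (k : Fin 3),
      (fun Y => β Y ^ 2) (X + Pi.single i (EuclideanSpace.single k L)) = (fun Y => β Y ^ 2) X := by
    intro X i k; simp only [hβper]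
  have hβ2symm : ∀ (σ : Equiv.Perm (Fin N)) (X : Config N),
      (fun Y => β Y ^ 2) (X ∘ σ) = (fun Y => β Y ^ 2) X := by
    intro σ X; simp only [hβsymm]
  have hb2 := hb (fun Y => β Y ^ 2) hβ2C hβ2per hβ2symm
  beta_reduce at hb2
  have hc : Tendsto (fun n => (∫ X in cellN N L, (β X ^ 2 * gradDot (F n) (F n) X +
      2 * (β X * F n X * gradDot β (F n) X) + F n X ^ 2 * gradDot β β X)) +
      (∫ X in cellN N L, F n X ^ 2 * (β X ^ 2 * Vr X)) - E₀ * ∫ X in cellN N L, F n X ^ 2 * β X ^ 2)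
      atTop (𝓝 (∫ X in cellN N L, Θ₀ X ^ 2 * gradDot β β X)) := by
    have hsum := hb2.add (conv (gradDot β β) BΓ (continuous_gradDot hβ hβ).measurable hBΓ)
    rw [zero_add] at hsum
    refine hsum.congr fun n => ?_
    have e := integral_cKin_eq (L := L) hβ (hFC n)
    beta_reduce at e
    rw [e]
    ring
  -- the remaining convergences and the passage to the limit
  have hβc := hβ.continuous
  have hβm : Measurable β := hβc.measurable
  have hβ2b : ∀ X, |β X ^ 2| ≤ Bβ ^ 2 := abs_sq_le_forall hBβ
  refine ⟨1 / (2 * Bβ + 2), hs₀, fun s hs t => ?_⟩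
  refine limit_response_ineq hW (conv β Bβ hβm hBβ) (conv _ _ (hβm.pow_const 2) hβ2b) ha
    (hb β hβ hβper hβsymm) hc (conv g Bg hg hBg)
    (conv _ _ (hβm.mul hg) (abs_mul_le_forall hBβ hBg))
    (conv _ _ ((hβm.pow_const 2).mul hg) (abs_mul_le_forall hβ2b hBg)) ?_
  filter_upwards [hERI β hβ hβper hβsymm Bβ hBβ] with n hn
  exact hn s hs t

end Summit.AtomisticToContinuum.BoseEinsteinCondensation.Theorems.CorrectorClosure.HealingScaleKacInsertion.ResponseDictionary

end
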